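import Summits.ResolutionOfSingularities.ResolutionOfSingularities.Theorems.FrobeniusClosingPatchingRelPerfectDepthPhaseCDetachedCylinder
import Literature.AlgebraicGeometry.Resolution.AlterationsEnlargingZ
import HarnessLib

/-!
# Crux `PatchingRelPerfect` (stmt-ResolutionOfSingularities-16161), chain W5.2 — F7(β) (β-AX) PHASE C,
# REACHABLE FAMILIES (i): the S1♯ run of the tangent-hosts pole `(α₂)`

[OURS · L1 W5.2 · F7(β) (β-AX) Phase C · res-L1-w52-plan-1 NAMING G11-7 (1) (T2″) / ANSWER 2026-08-27T16:09:56Z «RUNS»]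
res-L1-w52-stub-2 g5.  Replaces the role of NO printed item; NOT a statement of the manuscript under review (AI-written,
weaker than expert review).  MACHINE CHECK, at ring level over an ARBITRARY commutative ring, of a Phase C RUN under the
strategy S1♯ of RULING G11-14 (centres = irreducible COMPONENTS of `cosupp K` through a non-END point, admissible as is,
higher dimension first, tie-breaks TB1 «maximise the host contact order along the centre», TB2 «maximise the order of the
N-monomial», remaining ties free); END is read in the STRONG currency (hosts and members through the point are part of
ONE regular system of parameters; FLAG F1).  Reachability: `(α₂)` is the reachable pole of res-L1-w52-tri-2 TRIAGE v11.3
Row N3; the N3-pocket is the reachable configuration of res-L1-w52-tri-1 v26/v27 Row 3 (plan-1 G11-6 (1)); nothing is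
claimed for synthetic germs.  The one-step LETTER LAWS of the class `𝓛` are res-L1-w52-stub-1's
(`…DepthPhaseCLetterLaws`); here only the concrete steps of the two runs are stated.

## §1 `(α₂)`: `K = (x) + (x + y²) + (z t²)`, hosts `H₁ = V(x)` (bare), `H₂ = V(x + y²)`, members `E″ = V(t)`, `F̃ = V(z)`

`cosupp K = V(x, y, z) ∪ V(x, y, t)` (two curves through the pole, both admissible as is, both of host contact `2`);
TB2 (`ord (z t²)`: `2` on `V(x,y,t)`, `1` on `V(x,y,z)`) selects **move 1: `W₁ = V(x, y, t) ⊂ E″`** (`alpha_le`).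
Charts (`alphaX`, `alphaY`, `alphaT`): `x ↦ (g)`; `y ↦ g · A₁`, `A₁ = (x′) + (x′ + g) + (z g t′²)` (members `g, z, t′`);
`t ↦ g · B₁`, `B₁ = (x′) + (x′ + g y′²) + (z g)` (members `g, z`).
* Branch A: `cosupp A₁ = V(x′, g)` is a SURFACE (`H₁′ ∩ F₁`), strongly non-END (`x′, x′ + g, g` dependent; weakly it
  is END: `A₁ = (x′, g)`); **move 2: `W₂ = H₁′ ∩ F₁`** (`A1_le`): both charts `(h)` (`A1X`, `A1Y`: `x″ + 1` is absorbed
  by `x″`) — END (empty cosupport) after 2 moves.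
* Branch B: `cosupp B₁ = V(x′, g) ∪ V(x′, y′, z)`, dimension `2 > 1` ⇒ the SAME **move 2: `W₂ = H₁′ ∩ F₁`** (`B1_le`):
  `x ↦ (h)`, `t ↦ h · B₂`, `B₂ = (x″) + (x″ + y′²) + (z)` (`B1X`, `B1T`); then **move 3: `W₃ = V(x″, y′, z)`** = the strict
  transform of the cylinder `V(x, y, z)` (`B2_le`): `x, z ↦ (k)`, `y ↦ k · B₃`, `B₃ = (x‴) + (x‴ + k) + (z′)` (`B2X`,
  `B2Z`, `B2Y`); strongly non-END along `V(x‴, k, z′)` (`x‴, x‴ + k, k` dependent); **move 4: `W₄ = V(x‴, k, z′)`**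
  (`B3_le`): all three charts `(l)` (`B3X`, `B3Y`, `B3Z`).
So the S1♯ run of `(α₂)` principalises `K` — END with EMPTY cosupport, hence END in every currency — after **`2m = 4`**
moves on the worst branch (tri-2 kit j283236: TMN value 4), `2` on branch A.  `MultiHostState` words: every move has
`ν = 1`, host orders `1, 1` along the centre, and the N-monomial gains the new exceptional with exponent
`ord_W N − 1 ∈ {0, 1}`; the measure data `(dim W, host contact, ord_W N)` read `(1,2,2) → (2,1,1) → (1,2,1) → (1,1,1)`.
§2 gives the same identities as images under the Rees chart maps (`map_alpha_*`, `map_A1_*`, `map_B1_*`, `map_B2_*`,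
`map_B3_*`), i.e. as statements about the actual blow-up charts (controlled transform, `ν = 1`).

The N3-pocket run (ii) of the same NAMING is the companion module `…DepthPhaseCReachableFamiliesPocket` (400-line rule).
Fact-free; design / termination evidence for X3 (idea-1's measure memo LT-2, tri-2 TMN); no E-side content.

## References
* The Stacks Project, Tags 0804, 0BIQ (affine blow-up algebras and their charts). [StacksProject]
* A. J. de Jong, *Smoothness, semi-stability and alterations*, Publ. Math. IHÉS 83 (1996), 2.4. [DeJong1996]
* J. Kollár, *Lectures on Resolution of Singularities* (2007), (3.111) Step 3 (monomial bookkeeping). [Kollar2007]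
-/

-- `Summit.<Summit>.<Sub>.Theorems` with `Sub = Summit` (single-conjunct summit, D-0017)
set_option linter.dupNamespace false

noncomputable section

open IsLocalRing Literature.AlgebraicGeometry.Resolution

namespace Summit.ResolutionOfSingularities.ResolutionOfSingularities.Theorems

universe u

namespace DepthPhaseCRuns

open DepthPhaseC CuspMember

/-- `(α_m)`: `K = (x) + (x + y^m) + (z t²)`. -/
local notation3 "Kα[" x "," y "," z "," t "," m "]" =>
  (Ideal.span {x} ⊔ Ideal.span {x + y ^ m} ⊔ Ideal.span {z * t ^ 2})
/-- Branch A state after move 1: `A₁ = (x) + (x + y) + (z y t²)` (`y` the new exceptional). -/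
local notation3 "A1[" x "," y "," z "," t "]" =>
  (Ideal.span {x} ⊔ Ideal.span {x + y} ⊔ Ideal.span {z * y * t ^ 2})
/-- Branch B state after move 1: `B₁ = (x) + (x + t y²) + (z t)` (`t` the new exceptional). -/
local notation3 "B1[" x "," y "," z "," t "]" =>
  (Ideal.span {x} ⊔ Ideal.span {x + t * y ^ 2} ⊔ Ideal.span {z * t})
/-- Branch B state after move 2: `B₂ = (x) + (x + y²) + (z)`. -/
local notation3 "B2[" x "," y "," z "]" => (Ideal.span {x} ⊔ Ideal.span {x + y ^ 2} ⊔ Ideal.span {z})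
/-- Branch B state after move 3: `B₃ = (x) + (x + y) + (z)` (`y` the newest exceptional). -/
local notation3 "B3[" x "," y "," z "]" => (Ideal.span {x} ⊔ Ideal.span {x + y} ⊔ Ideal.span {z})

/-! ## §0 Glue -/

section Glue

variable {A : Type u} [CommRing A]

/-- `(x) + (x + 1) + (w) = ⊤`. [folklore] -/
theorem sup₃_eq_top_of_unit_step (x w : A) :
    Ideal.span {x} ⊔ Ideal.span {x + 1} ⊔ Ideal.span {w} = ⊤ := by
  rw [eq_top_iff, ← Ideal.span_singleton_one, Ideal.span_singleton_le_iff_mem]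
  have h1 : (x + 1) - x ∈ Ideal.span {x} ⊔ Ideal.span {x + 1} :=
    Ideal.sub_mem _ (Ideal.mem_sup_right (Ideal.mem_span_singleton_self _))
      (Ideal.mem_sup_left (Ideal.mem_span_singleton_self _))
  rw [add_sub_cancel_left] at h1
  exact Ideal.mem_sup_left h1

end Glue

/-! ## §1 The `(α₂)` run: legality and the substitution identities of every chart of every move -/

section Alpha

variable {A : Type u} [CommRing A]

/-- **Move 1 is legal** (`ν = 1`): `K ≤ (x, y, t)`; both hosts lie in the centre ideal. [folklore] -/
theorem alpha_le (x y z t : A) : Kα[x, y, z, t, 2] ≤ Ideal.span (Set.range ![x, y, t]) := by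
  rw [span_range_vec3]
  refine sup_le (sup_le (le_sup_of_le_left le_sup_left) ?_) ?_
  · rw [Ideal.span_singleton_le_iff_mem]
    exact Ideal.add_mem _ (Ideal.mem_sup_left (Ideal.mem_sup_left (Ideal.mem_span_singleton_self x)))
      (Ideal.mem_sup_left (Ideal.mem_sup_right (Ideal.mem_span_singleton.mpr ⟨y, by ring⟩)))
  · rw [Ideal.span_singleton_le_iff_mem]
    exact Ideal.mem_sup_right (Ideal.mem_span_singleton.mpr ⟨z * t, by ring⟩)

/-- **Move 1, `x`-chart** (`x = g`, `y = g y′`, `t = g t′`): `K ↦ (g)`. [folklore] -/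
theorem alphaX (y' z t' g : A) : Kα[g, g * y', z, g * t', 2] = Ideal.span {g} :=
  span_sup_sup_eq ⟨1 + g * y' ^ 2, by ring⟩ ⟨z * g * t' ^ 2, by ring⟩

/-- **Move 1, `y`-chart** (`y = g`, `x = g x′`, `t = g t′`): `K ↦ g · A₁(x′, g, z, t′)`. [folklore] -/
theorem alphaY (x' z t' g : A) : Kα[g * x', g, z, g * t', 2] = Ideal.span {g} * A1[x', g, z, t'] := by
  have e1 : g * x' + g ^ 2 = g * (x' + g) := by ring
  have e2 : z * (g * t') ^ 2 = g * (z * g * t' ^ 2) := by ring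
  rw [e1, e2]
  exact (span_singleton_mul_sup₃ _ _ _ _).symm

/-- **Move 1, `t`-chart** (`t = g`, `x = g x′`, `y = g y′`): `K ↦ g · B₁(x′, y′, z, g)`. [folklore] -/
theorem alphaT (x' y' z g : A) : Kα[g * x', g * y', z, g, 2] = Ideal.span {g} * B1[x', y', z, g] := by
  have e1 : g * x' + (g * y') ^ 2 = g * (x' + g * y' ^ 2) := by ring
  have e2 : z * g ^ 2 = g * (z * g) := by ring
  rw [e1, e2]
  exact (span_singleton_mul_sup₃ _ _ _ _).symm

/-- **Branch A, move 2 is legal**: `A₁ ≤ (x, y)` (the surface `H₁′ ∩ F₁`; both hosts contain it). [folklore] -/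
theorem A1_le (x y z t : A) : A1[x, y, z, t] ≤ Ideal.span (Set.range ![x, y]) := by
  rw [span_range_vec2]
  refine sup_le (sup_le le_sup_left ?_) ?_
  · rw [Ideal.span_singleton_le_iff_mem]
    exact Ideal.add_mem _ (Ideal.mem_sup_left (Ideal.mem_span_singleton_self x))
      (Ideal.mem_sup_right (Ideal.mem_span_singleton_self y))
  · rw [Ideal.span_singleton_le_iff_mem]
    exact Ideal.mem_sup_right (Ideal.mem_span_singleton.mpr ⟨z * t ^ 2, by ring⟩)

/-- **Branch A, move 2, `x`-chart** (`x = h`, `y = h y′`): `A₁ ↦ (h)`. [folklore] -/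
theorem A1X (y' z t h : A) : A1[h, h * y', z, t] = Ideal.span {h} :=
  span_sup_sup_eq ⟨1 + y', by ring⟩ ⟨z * y' * t ^ 2, by ring⟩

/-- **Branch A, move 2, `y`-chart** (`y = h`, `x = h x′`): `A₁ ↦ h · ((x′) + (x′ + 1) + (z t²)) = (h)` — END
(empty cosupport) on branch A. [folklore] -/
theorem A1Y (x' z t h : A) : A1[h * x', h, z, t] = Ideal.span {h} := by
  have e1 : h * x' + h = h * (x' + 1) := by ring
  have e2 : z * h * t ^ 2 = h * (z * t ^ 2) := by ring
  rw [e1, e2, ← span_singleton_mul_sup₃, sup₃_eq_top_of_unit_step, Ideal.mul_top]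

/-- **Branch B, move 2 is legal**: `B₁ ≤ (x, t)` (the surface `H₁′ ∩ F₁`, of dimension `2 > 1`). [folklore] -/
theorem B1_le (x y z t : A) : B1[x, y, z, t] ≤ Ideal.span (Set.range ![x, t]) := by
  rw [span_range_vec2]
  refine sup_le (sup_le le_sup_left ?_) ?_
  · rw [Ideal.span_singleton_le_iff_mem]
    exact Ideal.add_mem _ (Ideal.mem_sup_left (Ideal.mem_span_singleton_self x))
      (Ideal.mem_sup_right (Ideal.mem_span_singleton.mpr ⟨y ^ 2, by ring⟩))
  · rw [Ideal.span_singleton_le_iff_mem]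
    exact Ideal.mem_sup_right (Ideal.mem_span_singleton.mpr ⟨z, by ring⟩)

/-- **Branch B, move 2, `x`-chart** (`x = h`, `t = h t′`): `B₁ ↦ (h)`. [folklore] -/
theorem B1X (y z t' h : A) : B1[h, y, z, h * t'] = Ideal.span {h} :=
  span_sup_sup_eq ⟨1 + t' * y ^ 2, by ring⟩ ⟨z * t', by ring⟩

/-- **Branch B, move 2, `t`-chart** (`t = h`, `x = h x′`): `B₁ ↦ h · B₂(x′, y, z)`. [folklore] -/
theorem B1T (x' y z h : A) : B1[h * x', y, z, h] = Ideal.span {h} * B2[x', y, z] := by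
  have e1 : h * x' + h * y ^ 2 = h * (x' + y ^ 2) := by ring
  have e2 : z * h = h * z := by ring
  rw [e1, e2]
  exact (span_singleton_mul_sup₃ _ _ _ _).symm

/-- **Branch B, move 3 is legal**: `B₂ ≤ (x, y, z)` (the strict transform of the cylinder `V(x, y, z)`). [folklore] -/
theorem B2_le (x y z : A) : B2[x, y, z] ≤ Ideal.span (Set.range ![x, y, z]) := by
  rw [span_range_vec3]
  refine sup_le (sup_le (le_sup_of_le_left le_sup_left) ?_) le_sup_right
  rw [Ideal.span_singleton_le_iff_mem]
  exact Ideal.add_mem _ (Ideal.mem_sup_left (Ideal.mem_sup_left (Ideal.mem_span_singleton_self x)))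
    (Ideal.mem_sup_left (Ideal.mem_sup_right (Ideal.mem_span_singleton.mpr ⟨y, by ring⟩)))

/-- **Branch B, move 3, `x`-chart** (`x = k`, `y = k y′`, `z = k z′`): `B₂ ↦ (k)`. [folklore] -/
theorem B2X (y' z' k : A) : B2[k, k * y', k * z'] = Ideal.span {k} :=
  span_sup_sup_eq ⟨1 + k * y' ^ 2, by ring⟩ ⟨z', by ring⟩

/-- **Branch B, move 3, `z`-chart** (`z = k`, `x = k x′`, `y = k y′`): `B₂ ↦ (k)`. [folklore] -/
theorem B2Z (x' y' k : A) : B2[k * x', k * y', k] = Ideal.span {k} :=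
  sup_sup_span_eq ⟨x', by ring⟩ ⟨x' + k * y' ^ 2, by ring⟩

/-- **Branch B, move 3, `y`-chart** (`y = k`, `x = k x′`, `z = k z′`): `B₂ ↦ k · B₃(x′, k, z′)`. [folklore] -/
theorem B2Y (x' z' k : A) : B2[k * x', k, k * z'] = Ideal.span {k} * B3[x', k, z'] := by
  have e1 : k * x' + k ^ 2 = k * (x' + k) := by ring
  rw [e1]
  exact (span_singleton_mul_sup₃ _ _ _ _).symm

/-- **Branch B, move 4 is legal**: `B₃ ≤ (x, y, z)` (the curve `H₁ ∩ F₃ ∩ F̃`). [folklore] -/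
theorem B3_le (x y z : A) : B3[x, y, z] ≤ Ideal.span (Set.range ![x, y, z]) := by
  rw [span_range_vec3]
  refine sup_le (sup_le (le_sup_of_le_left le_sup_left) ?_) le_sup_right
  rw [Ideal.span_singleton_le_iff_mem]
  exact Ideal.add_mem _ (Ideal.mem_sup_left (Ideal.mem_sup_left (Ideal.mem_span_singleton_self x)))
    (Ideal.mem_sup_left (Ideal.mem_sup_right (Ideal.mem_span_singleton_self y)))

/-- **Branch B, move 4, `x`-chart**: `B₃ ↦ (l)`. [folklore] -/
theorem B3X (y' z' l : A) : B3[l, l * y', l * z'] = Ideal.span {l} :=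
  span_sup_sup_eq ⟨1 + y', by ring⟩ ⟨z', by ring⟩

/-- **Branch B, move 4, `y`-chart**: `B₃ ↦ l · ((x′) + (x′ + 1) + (z′)) = (l)`. [folklore] -/
theorem B3Y (x' z' l : A) : B3[l * x', l, l * z'] = Ideal.span {l} := by
  have e1 : l * x' + l = l * (x' + 1) := by ring
  rw [e1, ← span_singleton_mul_sup₃, sup₃_eq_top_of_unit_step, Ideal.mul_top]

/-- **Branch B, move 4, `z`-chart**: `B₃ ↦ (l)` — END (empty cosupport) on branch B after `2m = 4` moves. [folklore] -/
theorem B3Z (x' y' l : A) : B3[l * x', l * y', l] = Ideal.span {l} :=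
  sup_sup_span_eq ⟨x', by ring⟩ ⟨x' + y', by ring⟩

end Alpha

/-! ## §2 The same identities on the Rees charts (controlled transforms, `ν = 1`) -/

section Charts

variable {R : Type u} [CommRing R] (x y z t : R)

local notation3 "c₁" => (![x, y, t] : Fin 3 → R)
local notation3 "c₂" => (![x, y] : Fin 2 → R)
local notation3 "c₃" => (![x, t] : Fin 2 → R)
local notation3 "c₄" => (![x, y, z] : Fin 3 → R)

set_option maxHeartbeats 400000 in
-- instance-path defeq through `HomogeneousLocalization`'s standalone `Pow`/`Mul`
/-- **Move 1 on the Rees charts of `Bl_{(x,y,t)}`**: `x`-chart `K B = (x)`. [cite: StacksProject, Tag 0804] -/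
theorem map_alpha_zero : (Kα[x, y, z, t, 2]).map (chartBase c₁ 0) = Ideal.span {chartBase c₁ 0 x} := by
  have cy : chartBase c₁ 0 y = chartBase c₁ 0 x * chartGen c₁ 0 1 := reesChartBase_apply_eq_mul_chartGen c₁ 0 1
  have ct : chartBase c₁ 0 t = chartBase c₁ 0 x * chartGen c₁ 0 2 := reesChartBase_apply_eq_mul_chartGen c₁ 0 2
  rw [map_sup₃, map_add, map_mul, map_pow, map_pow, cy, ct]
  exact alphaX _ _ _ _

set_option maxHeartbeats 400000 in
-- instance-path defeq through `HomogeneousLocalization`'s standalone `Pow`/`Mul`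
/-- **Move 1, `y`-chart**: `K B = (y) · A₁(x/y, y, z, t/y)`. [cite: StacksProject, Tag 0804] -/
theorem map_alpha_one : (Kα[x, y, z, t, 2]).map (chartBase c₁ 1) =
    Ideal.span {chartBase c₁ 1 y} * A1[chartGen c₁ 1 0, chartBase c₁ 1 y, chartBase c₁ 1 z, chartGen c₁ 1 2] := by
  have cx : chartBase c₁ 1 x = chartBase c₁ 1 y * chartGen c₁ 1 0 := reesChartBase_apply_eq_mul_chartGen c₁ 1 0
  have ct : chartBase c₁ 1 t = chartBase c₁ 1 y * chartGen c₁ 1 2 := reesChartBase_apply_eq_mul_chartGen c₁ 1 2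
  rw [map_sup₃, map_add, map_mul, map_pow, map_pow, cx, ct]
  exact alphaY _ _ _ _

set_option maxHeartbeats 400000 in
-- instance-path defeq through `HomogeneousLocalization`'s standalone `Pow`/`Mul`
/-- **Move 1, `t`-chart**: `K B = (t) · B₁(x/t, y/t, z, t)`. [cite: StacksProject, Tag 0804] -/
theorem map_alpha_two : (Kα[x, y, z, t, 2]).map (chartBase c₁ 2) =
    Ideal.span {chartBase c₁ 2 t} * B1[chartGen c₁ 2 0, chartGen c₁ 2 1, chartBase c₁ 2 z, chartBase c₁ 2 t] := by
  have cx : chartBase c₁ 2 x = chartBase c₁ 2 t * chartGen c₁ 2 0 := reesChartBase_apply_eq_mul_chartGen c₁ 2 0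
  have cy : chartBase c₁ 2 y = chartBase c₁ 2 t * chartGen c₁ 2 1 := reesChartBase_apply_eq_mul_chartGen c₁ 2 1
  rw [map_sup₃, map_add, map_mul, map_pow, map_pow, cx, cy]
  exact alphaT _ _ _ _

set_option maxHeartbeats 400000 in
-- instance-path defeq through `HomogeneousLocalization`'s standalone `Pow`/`Mul`
/-- **Branch A, move 2 on the Rees charts of `Bl_{(x,y)}`** (letters of `A₁`): `x`-chart `(x)`. [cite: StacksProject, Tag 0804] -/
theorem map_A1_zero : (A1[x, y, z, t]).map (chartBase c₂ 0) = Ideal.span {chartBase c₂ 0 x} := by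
  have cy : chartBase c₂ 0 y = chartBase c₂ 0 x * chartGen c₂ 0 1 := reesChartBase_apply_eq_mul_chartGen c₂ 0 1
  rw [map_sup₃, map_add, map_mul, map_mul, map_pow, cy]
  exact A1X _ _ _ _

set_option maxHeartbeats 400000 in
-- instance-path defeq through `HomogeneousLocalization`'s standalone `Pow`/`Mul`
/-- **Branch A, move 2, `y`-chart**: `(y)` — END. [cite: StacksProject, Tag 0804] -/
theorem map_A1_one : (A1[x, y, z, t]).map (chartBase c₂ 1) = Ideal.span {chartBase c₂ 1 y} := by
  have cx : chartBase c₂ 1 x = chartBase c₂ 1 y * chartGen c₂ 1 0 := reesChartBase_apply_eq_mul_chartGen c₂ 1 0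
  rw [map_sup₃, map_add, map_mul, map_mul, map_pow, cx]
  exact A1Y _ _ _ _

set_option maxHeartbeats 400000 in
-- instance-path defeq through `HomogeneousLocalization`'s standalone `Pow`/`Mul`
/-- **Branch B, move 2 on the Rees charts of `Bl_{(x,t)}`** (letters of `B₁`): `x`-chart `(x)`. [cite: StacksProject, Tag 0804] -/
theorem map_B1_zero : (B1[x, y, z, t]).map (chartBase c₃ 0) = Ideal.span {chartBase c₃ 0 x} := by
  have ct : chartBase c₃ 0 t = chartBase c₃ 0 x * chartGen c₃ 0 1 := reesChartBase_apply_eq_mul_chartGen c₃ 0 1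
  rw [map_sup₃, map_add, map_mul, map_mul, map_pow, ct]
  exact B1X _ _ _ _

set_option maxHeartbeats 400000 in
-- instance-path defeq through `HomogeneousLocalization`'s standalone `Pow`/`Mul`
/-- **Branch B, move 2, `t`-chart**: `(t) · B₂(x/t, y, z)`. [cite: StacksProject, Tag 0804] -/
theorem map_B1_one : (B1[x, y, z, t]).map (chartBase c₃ 1) =
    Ideal.span {chartBase c₃ 1 t} * B2[chartGen c₃ 1 0, chartBase c₃ 1 y, chartBase c₃ 1 z] := by
  have cx : chartBase c₃ 1 x = chartBase c₃ 1 t * chartGen c₃ 1 0 := reesChartBase_apply_eq_mul_chartGen c₃ 1 0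
  rw [map_sup₃, map_add, map_mul, map_mul, map_pow, cx]
  exact B1T _ _ _ _

set_option maxHeartbeats 400000 in
-- instance-path defeq through `HomogeneousLocalization`'s standalone `Pow`/`Mul`
/-- **Branch B, move 3 on the Rees charts of `Bl_{(x,y,z)}`** (letters of `B₂`): `x`-chart `(x)`. [cite: StacksProject, Tag 0804] -/
theorem map_B2_zero : (B2[x, y, z]).map (chartBase c₄ 0) = Ideal.span {chartBase c₄ 0 x} := by
  have cy : chartBase c₄ 0 y = chartBase c₄ 0 x * chartGen c₄ 0 1 := reesChartBase_apply_eq_mul_chartGen c₄ 0 1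
  have cz : chartBase c₄ 0 z = chartBase c₄ 0 x * chartGen c₄ 0 2 := reesChartBase_apply_eq_mul_chartGen c₄ 0 2
  rw [map_sup₃, map_add, map_pow, cy, cz]
  exact B2X _ _ _

set_option maxHeartbeats 400000 in
-- instance-path defeq through `HomogeneousLocalization`'s standalone `Pow`/`Mul`
/-- **Branch B, move 3, `y`-chart**: `(y) · B₃(x/y, y, z/y)`. [cite: StacksProject, Tag 0804] -/
theorem map_B2_one : (B2[x, y, z]).map (chartBase c₄ 1) =
    Ideal.span {chartBase c₄ 1 y} * B3[chartGen c₄ 1 0, chartBase c₄ 1 y, chartGen c₄ 1 2] := by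
  have cx : chartBase c₄ 1 x = chartBase c₄ 1 y * chartGen c₄ 1 0 := reesChartBase_apply_eq_mul_chartGen c₄ 1 0
  have cz : chartBase c₄ 1 z = chartBase c₄ 1 y * chartGen c₄ 1 2 := reesChartBase_apply_eq_mul_chartGen c₄ 1 2
  rw [map_sup₃, map_add, map_pow, cx, cz]
  exact B2Y _ _ _

set_option maxHeartbeats 400000 in
-- instance-path defeq through `HomogeneousLocalization`'s standalone `Pow`/`Mul`
/-- **Branch B, move 3, `z`-chart**: `(z)`. [cite: StacksProject, Tag 0804] -/
theorem map_B2_two : (B2[x, y, z]).map (chartBase c₄ 2) = Ideal.span {chartBase c₄ 2 z} := by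
  have cx : chartBase c₄ 2 x = chartBase c₄ 2 z * chartGen c₄ 2 0 := reesChartBase_apply_eq_mul_chartGen c₄ 2 0
  have cy : chartBase c₄ 2 y = chartBase c₄ 2 z * chartGen c₄ 2 1 := reesChartBase_apply_eq_mul_chartGen c₄ 2 1
  rw [map_sup₃, map_add, map_pow, cx, cy]
  exact B2Z _ _ _

set_option maxHeartbeats 400000 in
-- instance-path defeq through `HomogeneousLocalization`'s standalone `Pow`/`Mul`
/-- **Branch B, move 4 on the Rees charts of `Bl_{(x,y,z)}`** (letters of `B₃`): `x`-chart `(x)`. [cite: StacksProject, Tag 0804] -/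
theorem map_B3_zero : (B3[x, y, z]).map (chartBase c₄ 0) = Ideal.span {chartBase c₄ 0 x} := by
  have cy : chartBase c₄ 0 y = chartBase c₄ 0 x * chartGen c₄ 0 1 := reesChartBase_apply_eq_mul_chartGen c₄ 0 1
  have cz : chartBase c₄ 0 z = chartBase c₄ 0 x * chartGen c₄ 0 2 := reesChartBase_apply_eq_mul_chartGen c₄ 0 2
  rw [map_sup₃, map_add, cy, cz]
  exact B3X _ _ _

set_option maxHeartbeats 400000 in
-- instance-path defeq through `HomogeneousLocalization`'s standalone `Pow`/`Mul`
/-- **Branch B, move 4, `y`-chart**: `(y)`. [cite: StacksProject, Tag 0804] -/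
theorem map_B3_one : (B3[x, y, z]).map (chartBase c₄ 1) = Ideal.span {chartBase c₄ 1 y} := by
  have cx : chartBase c₄ 1 x = chartBase c₄ 1 y * chartGen c₄ 1 0 := reesChartBase_apply_eq_mul_chartGen c₄ 1 0
  have cz : chartBase c₄ 1 z = chartBase c₄ 1 y * chartGen c₄ 1 2 := reesChartBase_apply_eq_mul_chartGen c₄ 1 2
  rw [map_sup₃, map_add, cx, cz]
  exact B3Y _ _ _

set_option maxHeartbeats 400000 in
-- instance-path defeq through `HomogeneousLocalization`'s standalone `Pow`/`Mul`
/-- **Branch B, move 4, `z`-chart**: `(z)` — END, the run is over. [cite: StacksProject, Tag 0804] -/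
theorem map_B3_two : (B3[x, y, z]).map (chartBase c₄ 2) = Ideal.span {chartBase c₄ 2 z} := by
  have cx : chartBase c₄ 2 x = chartBase c₄ 2 z * chartGen c₄ 2 0 := reesChartBase_apply_eq_mul_chartGen c₄ 2 0
  have cy : chartBase c₄ 2 y = chartBase c₄ 2 z * chartGen c₄ 2 1 := reesChartBase_apply_eq_mul_chartGen c₄ 2 1
  rw [map_sup₃, map_add, cx, cy]
  exact B3Z _ _ _

end Charts

end DepthPhaseCRuns

end Summit.ResolutionOfSingularities.ResolutionOfSingularities.Theorems

end
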